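import Summits.ABC.StewartYu.PadicG3Radius
import Summits.ABC.StewartYu.PadicG3TwoFunctions
import HarnessLib

/-!
# Cell abc-stewartyu, crux `Y07Odd` (stmt-ABC-19658), line `gen3-slab-odd`: the FAMILY OF `p`-ADIC CLASS FUNCTIONS
# `f_τ` of the odd-`p` Gen-3 frame — Hasse weights in `Y₀`, powers of the `b`-eliminated coefficients, depth-`m+1`
# exponents (the slab), and the differential equations on the big disc `‖z‖ < p^m √p`

`Summits/ABC/StewartYu/PadicG3Functions.lean` — cell `abc-stewartyu` (design HOME/p2/SETUP3-SPEC.md §C/§G + HANDOFF addendum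
2026-08-27T00:05Z; seat p2-g4, F-odd lead).  Definitions (functions of the datum `G3Setup`) and theorems; no named fact.  Odd-`p` twin
of p3-g5's `PadicG3TwoFunctions.lean` (same shape and names; its generic `TwoSetup.derivative_hasseDeriv_eq` is reused), with the slab built in: the family is indexed by an
arbitrary type `ι` (the frame: `unk L₀ 𝔏`), each index carrying a `Y₀`-factor `R i ∈ ℚ[Y₀]` (the frame: Fel'dman's
`num_{ℓ₀,H}(2^{S−s}Y₀)`) and an INTEGER exponent vector `v i : Fin n → ℤ` — in the frame the RELATIVE exponent `λ − λ♭` w.r.t. the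
base point of the slab class, so that `‖E(v i)‖ ≤ p^{−(m+1)}` (`G3Setup.IsSlab`, `norm_eResc_le`-type bound) and the functions live on
the big disc of `PadicG3Radius` (gain `(m+½) log p` per zero).  The directional coefficients are `zγ v k = 𝔛 v k / b_{j₀}`
(`p`-integral by the pivot's minimality; `zγ v j₀ = 0`), and `E v = Σ_k zγ v k · lg k` (`G3Setup.E_eq_sum_𝔛`).

* `hw R i t₀` (Hasse weight in `ℚ_p[X]`), `zγ`, `zγpow v i t = ∏_k zγ(v i)_k^{t_k}`;
* `g3termF`, `g3F B p τ z = Σ_{i∈B} pᵢ·(Hasse_{t₀}Rᵢ)(z)·zγpow·exp(E(vᵢ)·z)`, and `g3Φ`/`g3φ` with the exact exponent `Lsum` /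
  the rational values at integer points;
* **the differential equations** `hasDerivAt_g3termF` / `hasDerivAt_g3F`:
  `d/dz f_τ = (t₀+1)·f_{τ+e₀} + Σ_k lg k · f_{τ+e_k}` on `‖z‖ < p^m √p` when `‖E(vᵢ)‖ ≤ p^{−(m+1)}` on `B` — ALL coefficients of norm
  `≤ 1` (`norm_g3coef_le`), exactly as in the M2/p = 2 files, because the slab enters only through the radius.

WHAT THIS IS NOT: jets-vs-values, sizes and the `f − φ` comparison are the sequel (`PadicG3FunctionsB`); no crux moves.

References: Yu. V. Nesterenko, LNM 1819 (2003), (4.16)–(4.20); K. Yu, Acta Math. 211 (2013), (5.8)–(5.12); Acta Arith. 89 (1999) §10.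
-/

noncomputable section

open NormedSpace Finset IsUltrametricDist Polynomial Metric
open Literature.NumberTheory.Transcendental
open Literature.NumberTheory.Transcendental.Baker1975 (bump bump_apply sum_bump)
open Literature.NumberTheory.Transcendental.CW77.Setup (Tau tauNorm bump0 bumpj bumpτ tauNorm_bumpτ
  bumpτ_zero bumpτ_succ)
open scoped Nat Topology

namespace Summit.ABC.StewartYu

namespace G3Setup

variable {p : ℕ} [Fact p.Prime] (S : G3Setup p) {ι : Type*} (R : ι → ℚ[X]) (v : ι → Fin S.n → ℤ)

/-! ### The `Y₀`-weights (Hasse derivatives, read in `ℚ_p`) -/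

/-- The `Y₀`-weight polynomial `Hasse_{t₀} Rᵢ` read in `ℚ_p[X]`. [cite: Nesterenko2003, §3.5 (3.34)] -/
def hw (i : ι) (t₀ : ℕ) : ℚ_[p][X] := (hasseDeriv t₀ (R i)).map (algebraMap ℚ ℚ_[p])

/-- At an integer point the weight is the rational number `(Hasse_{t₀} Rᵢ)(x)`. [folklore] -/
theorem hw_eval_intCast (i : ι) (t₀ : ℕ) (x : ℤ) :
    (hw (p := p) R i t₀).eval (x : ℚ_[p]) = (((hasseDeriv t₀ (R i)).eval (x : ℚ) : ℚ) : ℚ_[p]) := by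
  unfold hw
  rw [Polynomial.eval_intCast_map, eq_ratCast]

/-- The derivative of the weight, evaluated: `(hw i t₀)'(z) = (t₀+1)·(hw i (t₀+1))(z)`. [folklore] -/
theorem eval_derivative_hw (i : ι) (t₀ : ℕ) (z : ℚ_[p]) :
    (derivative (hw (p := p) R i t₀)).eval z = ((t₀ + 1 : ℕ) : ℚ_[p]) * (hw (p := p) R i (t₀ + 1)).eval z := by
  unfold hw
  rw [Polynomial.derivative_map, TwoSetup.derivative_hasseDeriv_eq]
  have e : ((t₀ + 1) • hasseDeriv (t₀ + 1) (R i)).map (algebraMap ℚ ℚ_[p]) =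
      (t₀ + 1) • (hasseDeriv (t₀ + 1) (R i)).map (algebraMap ℚ ℚ_[p]) :=
    map_nsmul (Polynomial.mapRingHom (algebraMap ℚ ℚ_[p])) (t₀ + 1) _
  rw [e, Polynomial.eval_smul, nsmul_eq_mul]

/-! ### The directional coefficients `zγ = 𝔛 / b_{j₀}` and their powers -/

/-- `zγ v k = 𝔛 v k / b_{j₀}` (Nesterenko's `𝔛ₖ(λ)/bₙ`; `zγ v j₀ = 0`). [cite: Nesterenko2003, §4.2 (4.17)] -/
def zγ (w : Fin S.n → ℤ) (k : Fin S.n) : ℚ := (S.𝔛 w k : ℚ) / (S.b S.j₀ : ℚ)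

/-- `‖zγ v k‖_p ≤ 1` (the pivot has minimal order). [folklore] -/
theorem norm_zγ_le (w : Fin S.n → ℤ) (k : Fin S.n) : ‖(S.zγ w k : ℚ_[p])‖ ≤ 1 := by
  have hb : (S.b S.j₀ : ℚ_[p]) ≠ 0 := S.bj₀_ne'
  have h : (S.zγ w k : ℚ_[p]) = (w k : ℚ_[p]) - ((S.b k : ℚ_[p]) / (S.b S.j₀ : ℚ_[p])) * (w S.j₀ : ℚ_[p]) := by
    unfold zγ 𝔛
    push_cast
    field_simp
  rw [h, sub_eq_add_neg]
  refine (IsUltrametricDist.norm_add_le_max _ _).trans (max_le (Padic.norm_int_le_one _) ?_)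
  rw [norm_neg, norm_mul]
  exact mul_le_one₀ (S.norm_b_div_le k) (norm_nonneg _) (Padic.norm_int_le_one _)

/-- **`E v = Σ_k zγ v k · lg k`** (so the derivative of `exp(E v · z)` is the sum of the direction bumps).
[cite: Nesterenko2003, §4.2 (4.17), (4.20)] -/
theorem E_eq_sum_zγ (w : Fin S.n → ℤ) : S.E w = ∑ k, (S.zγ w k : ℚ_[p]) * S.lg k := by
  rw [S.E_eq_sum_𝔛, mul_sum]
  refine sum_congr rfl fun k _ => ?_
  unfold zγ
  push_cast
  ring

/-- `∏_k zγ(vᵢ)_k^{t_k} ∈ ℚ`. [cite: Nesterenko2003, §4.2 (4.20)] -/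
def zγpow (i : ι) (t : Fin S.n → ℕ) : ℚ := ∏ k, S.zγ (v i) k ^ t k

/-- `‖zγpow‖_p ≤ 1`. [folklore] -/
theorem norm_zγpow_le (i : ι) (t : Fin S.n → ℕ) : ‖(S.zγpow v i t : ℚ_[p])‖ ≤ 1 := by
  unfold zγpow; push_cast
  rw [norm_prod]
  exact prod_le_one (fun k _ => norm_nonneg _) fun k _ => by
    rw [norm_pow]; exact pow_le_one₀ (norm_nonneg _) (S.norm_zγ_le _ k)

/-- `zγpow(t + e_k) = zγpow(t) · zγ_k` in `ℚ_p`. [folklore] -/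
theorem zγpow_bump_cast (i : ι) (t : Fin S.n → ℕ) (k : Fin S.n) :
    (S.zγpow v i (bump t k) : ℚ_[p]) = (S.zγpow v i t : ℚ_[p]) * (S.zγ (v i) k : ℚ_[p]) := by
  unfold zγpow; push_cast
  simp_rw [bump_apply, pow_add, prod_mul_distrib]
  congr 1
  rw [Fintype.prod_eq_single k (fun k' hk' => by rw [if_neg hk', pow_zero]), if_pos rfl, pow_one]

/-! ### The functions -/

/-- One term of `f_τ`: `(Hasse_{t₀} Rᵢ)(z) · ∏ zγ_k^{t_k} · exp(E(vᵢ)·z)`. [cite: Nesterenko2003, §4.2 (4.17)] -/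
def g3termF (i : ι) (τ : Tau S.n) (z : ℚ_[p]) : ℚ_[p] :=
  (hw (p := p) R i τ.1).eval z * (S.zγpow v i τ.2 : ℚ_[p]) * exp (S.E (v i) * z)

/-- One term of `φ_τ`: the same with the exact exponent `Lsum`. [cite: Nesterenko2003, §4 (4.7)] -/
def g3termΦ (i : ι) (τ : Tau S.n) (z : ℚ_[p]) : ℚ_[p] :=
  (hw (p := p) R i τ.1).eval z * (S.zγpow v i τ.2 : ℚ_[p]) * exp (S.Lsum (v i) * z)

/-- **`f_τ(z) = Σ_{i∈B} pᵢ · g3termF`**. [cite: Nesterenko2003, §4.2 (4.17)] -/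
def g3F (B : Finset ι) (pv : ι → ℤ) (τ : Tau S.n) (z : ℚ_[p]) : ℚ_[p] :=
  ∑ i ∈ B, (pv i : ℚ_[p]) * S.g3termF R v i τ z

/-- **`φ_τ(z) = Σ_{i∈B} pᵢ · g3termΦ`**. [cite: Nesterenko2003, §4 (4.7)] -/
def g3Φ (B : Finset ι) (pv : ι → ℤ) (τ : Tau S.n) (z : ℚ_[p]) : ℚ_[p] :=
  ∑ i ∈ B, (pv i : ℚ_[p]) * S.g3termΦ R v i τ z

/-- **The rational value `φ_τ(x)`** at an integer point: `Σ pᵢ · (Hasse_{t₀}Rᵢ)(x) · zγpow · ∏ⱼ αⱼ^{vᵢⱼ x}` (the frame's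
native identity is `g3φ τ x = 0`; the twist class contributes the common root of unity `cls(vᵢ)^x`, constant on a class).
[cite: Nesterenko2003, §4 (4.6)–(4.7)] -/
def g3φ (B : Finset ι) (pv : ι → ℤ) (τ : Tau S.n) (x : ℤ) : ℚ :=
  ∑ i ∈ B, (pv i : ℚ) * (hasseDeriv τ.1 (R i)).eval (x : ℚ) * S.zγpow v i τ.2 * ∏ j, S.α j ^ (v i j * x)

/-! ### The differential equations on the big disc -/

/-- **The derivative of one term**: `d/dz g3termF_τ = (t₀+1)·g3termF_{τ+e₀} + Σ_k lg k · g3termF_{τ+e_k}` on `‖z‖ < p^m √p`,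
for a depth-`m+1` exponent. [cite: Nesterenko2003, §4.2 (4.20)] -/
theorem hasDerivAt_g3termF (m : ℕ) (i : ι) (hi : ‖S.E (v i)‖ ≤ (p : ℝ)⁻¹ ^ (m + 1)) (τ : Tau S.n) {z : ℚ_[p]}
    (hz : ‖z‖ < (p : ℝ) ^ m * Real.sqrt p) :
    HasDerivAt (S.g3termF R v i τ)
      (((τ.1 + 1 : ℕ) : ℚ_[p]) * S.g3termF R v i (bump0 τ) z +
        ∑ k : Fin S.n, S.lg k * S.g3termF R v i (bumpj τ k) z) z := by
  have h1 : HasDerivAt (fun w => (hw (p := p) R i τ.1).eval w)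
      (((τ.1 + 1 : ℕ) : ℚ_[p]) * (hw (p := p) R i (τ.1 + 1)).eval z) z := by
    have h := Polynomial.hasDerivAt (hw (p := p) R i τ.1) z
    rw [eval_derivative_hw R] at h
    exact h
  have h2 : HasDerivAt (fun w => (S.zγpow v i τ.2 : ℚ_[p]) * exp (S.E (v i) * w))
      ((S.zγpow v i τ.2 : ℚ_[p]) * (S.E (v i) * exp (S.E (v i) * z))) z :=
    (S.hasDerivAt_exp_mul_depth m hi hz).const_mul _
  have hsplit : S.g3termF R v i τ =
      fun w => (hw (p := p) R i τ.1).eval w * ((S.zγpow v i τ.2 : ℚ_[p]) * exp (S.E (v i) * w)) := by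
    funext w; simp only [g3termF]; ring
  rw [hsplit]
  refine (h1.mul h2).congr_deriv ?_
  have er : ∀ k : Fin S.n, S.lg k * S.g3termF R v i (bumpj τ k) z =
      (hw (p := p) R i τ.1).eval z * ((S.zγpow v i τ.2 : ℚ_[p]) * exp (S.E (v i) * z)) *
        ((S.zγ (v i) k : ℚ_[p]) * S.lg k) := by
    intro k
    simp only [g3termF, bumpj]
    rw [S.zγpow_bump_cast]
    ring
  simp_rw [er]
  rw [← mul_sum, ← S.E_eq_sum_zγ]
  simp only [g3termF, bump0]
  ring

/-- The coefficients of the differential equation at `τ`: `t₀ + 1` in the `Y₀`-direction, `lg k` in direction `k`.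
[cite: Nesterenko2003, §4.2 (4.20)] -/
def g3coef (τ : Tau S.n) (i : Fin (S.n + 1)) : ℚ_[p] :=
  Fin.cases (((τ.1 + 1 : ℕ) : ℚ_[p])) (fun k => S.lg k) i

/-- `‖g3coef τ i‖ ≤ 1` — the slab does NOT enlarge the coefficients. [folklore] -/
theorem norm_g3coef_le (τ : Tau S.n) (i : Fin (S.n + 1)) : ‖S.g3coef τ i‖ ≤ 1 := by
  refine Fin.cases ?_ (fun k => ?_) i
  · simp only [g3coef, Fin.cases_zero]
    exact_mod_cast Padic.norm_int_le_one (p := p) ((τ.1 + 1 : ℕ) : ℤ)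
  · simp only [g3coef, Fin.cases_succ]
    exact (S.norm_lg_le k).trans S.inv_p_lt_one.le

/-- **`d/dz f_τ = Σᵢ cᵢ(τ) f_{τ+eᵢ}`** on `‖z‖ < p^m √p` when all exponents on `B` have depth `m+1`.
[cite: Nesterenko2003, §4.2 (4.20)] -/
theorem hasDerivAt_g3F (m : ℕ) (B : Finset ι) (hB : ∀ i ∈ B, ‖S.E (v i)‖ ≤ (p : ℝ)⁻¹ ^ (m + 1)) (pv : ι → ℤ)
    (τ : Tau S.n) {z : ℚ_[p]} (hz : ‖z‖ < (p : ℝ) ^ m * Real.sqrt p) :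
    HasDerivAt (S.g3F R v B pv τ)
      (∑ i : Fin (S.n + 1), S.g3coef τ i * S.g3F R v B pv (bumpτ τ i) z) z := by
  unfold g3F
  have h := HasDerivAt.fun_sum fun i (hi : i ∈ B) =>
    (S.hasDerivAt_g3termF R v m i (hB i hi) τ hz).const_mul (pv i : ℚ_[p])
  refine h.congr_deriv ?_
  have h0 : S.g3coef τ 0 = ((τ.1 + 1 : ℕ) : ℚ_[p]) := rfl
  have hs : ∀ k : Fin S.n, S.g3coef τ k.succ = S.lg k := fun k => rfl
  simp only [Fin.sum_univ_succ, h0, hs, bumpτ_zero, bumpτ_succ, mul_add, sum_add_distrib, mul_sum]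
  congr 1
  · exact sum_congr rfl fun i _ => by ring
  · rw [sum_comm]
    exact sum_congr rfl fun k _ => sum_congr rfl fun i _ => by ring

end G3Setup

end Summit.ABC.StewartYu

end
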